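import Literature.Computability.Complexity.FKPointLocationRecordsFP
import HarnessLib

/-!
# Fournier–Koiran point location, XIII: the protocol transition is computed in polynomial time

Topic `Literature/Computability/Complexity`, grouping namespace `FKPointLocation`. The untyped
transition `uupd` of the location protocol (`FKPointLocationUntyped.lean`; Fournier–Koiran, ICALP
2000 = LIP RR-1999-21, §2.1 Steps 1 and k) as a typed polynomial-time program on codes
(`CodeFP`): its branches as named functions (`bsBr` binary search, `pfBr` chain prefix bits,
`stBr` stability, `apBr` apex prefix bits, `faBr` facet choice; `uupd_eq` is the tag dispatch),
one `CodeFP` statement per branch (`bsBrFP`, …, `closeBrFP` for `ufinishLevel`), and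
**`uupdFP`**: `(P, d, τ, b) ↦ uupd P d τ b` is computed in polynomial time. This is the step of
the clocked state machine that the oracle algorithm of Theorem 3 replays on the answer bits
(report p. 4: "tedious but completely straightforward").

## References

* H. Fournier, P. Koiran, *Lower bounds are not easier over the reals: inside PH*, ICALP 2000,
  LNCS 1853 = LIP RR-1999-21, §2.1 (Steps 1 and k), §2.2, Thm 3 (p. 11). [FournierKoiran2000]
* S. Arora, B. Barak, *Computational Complexity: A Modern Approach*, CUP 2009, §1.3. [AroraBarak2009]
-/

namespace Literature.Computability.Complexity

namespace FKPointLocation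

open _root_.Computability CodeFP Polynomial

/-! ### The branches of the transition -/

section Branches

/-- The binary-search branch of `uupd` (task `bs i k`). [cite: FournierKoiran2000, §2.1 Step 1] -/
def bsBr (P : UParams) (d : UData) (i k : ℕ) (b : Bool) : UData :=
  if vget d.chart i ≠ 0 then
    (if k = P.L then
      { d with cur := { d.cur with m := d.cur.m.set i (vget d.chart i * 2 ^ (P.L + 1)), bsAcc := 0 } }
     else d)
  else
    let acc := if k = 0 then 0 else d.cur.bsAcc
    let acc' := 2 * acc + b.toNat
    if k = P.L then
      { d with cur := { d.cur with m := d.cur.m.set i (2 * (acc' : ℤ) + 1 - 2 ^ (P.L + 1)), bsAcc := 0 } }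
    else { d with cur := { d.cur with bsAcc := acc' } }

/-- The prefix-bit branch of `uupd` (task `pf sc m w`). [cite: FournierKoiran2000, §2.1 (prefix search)] -/
def pfBr (P : UParams) (d : UData) (w : ℕ) (b : Bool) : UData :=
  if d.cur.exOk then
    let bits' := d.cur.bits ++ [b]
    if w + 1 = P.Wf then
      { d with cur := { d.cur with chain := d.cur.chain ++ [udecodeForm P.bB P.D bits'], bits := [], exOk := false } }
    else { d with cur := { d.cur with bits := bits' } }
  else d

/-- The stability branch of `uupd` (task `st sc`). [cite: FournierKoiran2000, §2.1] -/
def stBr (d : UData) (sc : ℕ) (b : Bool) : UData :=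
  { d with cur := { d.cur with stable := stableUpd d.cur.stable b sc d.cur.chain, chain := [], bits := [], exOk := false } }

/-- The apex-bit branch of `uupd` (task `ap w`). [cite: FournierKoiran2000, §2.1] -/
def apBr (P : UParams) (d : UData) (w : ℕ) (b : Bool) : UData :=
  let bits' := d.cur.bits ++ [b]
  if w + 1 = P.Wa then
    { d with cur := { d.cur with apexN := (udecodeApex P.W P.D bits').1, apexD := (udecodeApex P.W P.D bits').2, bits := [] } }
  else { d with cur := { d.cur with bits := bits' } }

/-- The facet branch of `uupd` (task `fa i`). [cite: FournierKoiran2000, §2.1] -/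
def faBr (d : UData) (i : ℕ) (b : Bool) : UData :=
  { d with cur := { d.cur with cand := candUpd d.cur.cand (d.validB i) b i } }

/-- **The tag dispatch of the transition.** [cite: FournierKoiran2000, §2.1 Steps 1 and k] -/
theorem uupd_eq (P : UParams) (d : UData) (τ : UTask) (b : Bool) :
    uupd P d τ b =
      if d.done then d
      else if τ.tag = 0 then bsBr P d (τ.args.getD 0 0) (τ.args.getD 1 0) b
      else if τ.tag = 1 then { d with cur := { d.cur with exOk := b, bits := [] } }
      else if τ.tag = 2 then pfBr P d (τ.args.getD 2 0) b
      else if τ.tag = 3 then stBr d (τ.args.getD 0 0) b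
      else if τ.tag = 4 then apBr P d (τ.args.getD 0 0) b
      else if τ.tag = 5 then { d with cur := { d.cur with ge := d.cur.ge.set (τ.args.getD 0 0) b } }
      else if τ.tag = 6 then { d with cur := { d.cur with le := d.cur.le.set (τ.args.getD 0 0) b } }
      else if τ.tag = 7 then faBr d (τ.args.getD 0 0) b
      else if τ.tag = 8 then ufinishLevel P d
      else { d with out := b } := by
  unfold uupd
  by_cases hd : d.done
  · simp [hd]
  · simp only [if_neg hd]
    cases τ <;> simp only [UTask.tag, UTask.args, List.getD_cons_zero, List.getD_cons_succ, List.getD_nil,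
      Nat.reduceEqDiff, reduceIte] <;> rfl

end Branches

/-! ### The branches, on codes -/

section BranchesFP

/-- Shapes of the new stable-scale field. [folklore] -/
theorem stableUpd_fst (st : Option (ℕ × List (List ℤ))) (b : Bool) (sc : ℕ) (ch : List (List ℤ)) :
    (stableUpd st b sc ch).map Prod.fst =
      if (st.map Prod.fst).isSome then st.map Prod.fst else if b then none else some sc := by
  cases st <;> cases b <;> rfl

/-- Shapes of the new stable-chain field. [folklore] -/
theorem stableUpd_snd (st : Option (ℕ × List (List ℤ))) (b : Bool) (sc : ℕ) (ch : List (List ℤ)) :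
    ((stableUpd st b sc ch).map Prod.snd).getD [] =
      if (st.map Prod.fst).isSome then (st.map Prod.snd).getD [] else if b then [] else ch := by
  cases st <;> cases b <;> rfl

/-- The new facet candidate as a raw list. [folklore] -/
theorem candUpd_toList (cand : Option ℕ) (v b : Bool) (i : ℕ) :
    (candUpd cand v b i).toList =
      if cand.toList.isEmpty then (if v then [i] else []) else (if v && !b then [i] else cand.toList) := by
  cases cand <;> cases v <;> cases b <;> rfl

/-- `ufinishLevel` without a `match`. [folklore] -/
theorem ufinishLevel_eq (P : UParams) (d : UData) :
    ufinishLevel P d =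
      ⟨if d.cur.cand.isSome then d.done else true, d.out,
        if d.cur.cand.isSome then d.chart.set (d.cur.cand.getD 0) (if d.cur.ge.getD (d.cur.cand.getD 0) false then 1 else -1) else d.chart,
        ucloseRec d.cur (d.cur.cand.getD 0)
          (if d.cur.cand.isSome then (if d.cur.ge.getD (d.cur.cand.getD 0) false then 1 else -1) else 1) :: d.levels,
        UScratch.init P.D⟩ := by
  obtain ⟨dn, out, chart, levels, cur⟩ := d
  obtain ⟨m, acc, chain, ex, bits, stable, aN, aD, ge, le, cand⟩ := cur
  cases cand <;> rfl

/-- The existence branch (`ex`): reset the prefix bits, record the answer. [cite: FournierKoiran2000, §2.1] -/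
theorem exBrFP : CodeFP uinE dataE (fun q : UIn => { q.2.1 with cur := { q.2.1.cur with exOk := q.2.2.2, bits := [] } }) :=
  data_withCur uin_d (scr_ofFields (c := fun q : UIn => { q.2.1.cur with exOk := q.2.2.2, bits := [] })
    (setF 4 (scr_setF 3 uin_cur (ofStrE uin_b)) (const uinE ([] : List Bool))) fun _ => rfl)

/-- The equality-test branches (`eqGe`, `eqLe`). [cite: FournierKoiran2000, §2.1] -/
theorem geBrFP : CodeFP uinE dataE (fun q : UIn => { q.2.1 with cur := { q.2.1.cur with ge := q.2.1.cur.ge.set (q.2.2.1.args.getD 0 0) q.2.2.2 } }) :=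
  data_withCur uin_d (scr_ofFields (c := fun q : UIn => { q.2.1.cur with ge := q.2.1.cur.ge.set (q.2.2.1.args.getD 0 0) q.2.2.2 })
    (scr_setF 9 uin_cur (ofStrE ((rawSet bitE).comp ((scr_ge.comp uin_cur).pair ((uin_arg 0).pair uin_b)) :))) fun _ => rfl)

/-- The second equality-test branch (`eqLe`). [cite: FournierKoiran2000, §2.1] -/
theorem leBrFP : CodeFP uinE dataE (fun q : UIn => { q.2.1 with cur := { q.2.1.cur with le := q.2.1.cur.le.set (q.2.2.1.args.getD 0 0) q.2.2.2 } }) :=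
  data_withCur uin_d (scr_ofFields (c := fun q : UIn => { q.2.1.cur with le := q.2.1.cur.le.set (q.2.2.1.args.getD 0 0) q.2.2.2 })
    (scr_setF 10 uin_cur (ofStrE ((rawSet bitE).comp ((scr_le.comp uin_cur).pair ((uin_arg 0).pair uin_b)) :))) fun _ => rfl)

/-- The output branch (`fin`). [folklore] -/
theorem finBrFP : CodeFP uinE dataE (fun q : UIn => { q.2.1 with out := q.2.2.2 }) :=
  data_ofFields (data_setF 1 uin_d (ofStrE uin_b)) fun _ => rfl

/-- The stability branch (`st`). [cite: FournierKoiran2000, §2.1] -/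
theorem stBrFP : CodeFP uinE dataE (fun q : UIn => stBr q.2.1 (q.2.2.1.args.getD 0 0) q.2.2.2) := by
  have hstSc : CodeFP uinE (optE natE) (fun q : UIn => q.2.1.cur.stable.map Prod.fst) := (scr_stSc.comp uin_cur :)
  have hstCh : CodeFP uinE (rawE vecE) (fun q : UIn => (q.2.1.cur.stable.map Prod.snd).getD []) := (scr_stChain.comp uin_cur :)
  have hsome : CodeFP uinE bitE (fun q : UIn => (q.2.1.cur.stable.map Prod.fst).isSome) := optIsSomeN hstSc
  have hsc' : CodeFP uinE (optE natE) (fun q : UIn => (stableUpd q.2.1.cur.stable q.2.2.2 (q.2.2.1.args.getD 0 0) q.2.1.cur.chain).map Prod.fst) :=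
    (hsome.ite hstSc (uin_b.ite (const uinE (none : Option ℕ)) (optSomeN (uin_arg 0)))).congr fun q => by
      rw [stableUpd_fst]
  have hch' : CodeFP uinE (rawE vecE) (fun q : UIn => ((stableUpd q.2.1.cur.stable q.2.2.2 (q.2.2.1.args.getD 0 0) q.2.1.cur.chain).map Prod.snd).getD []) :=
    (hsome.ite hstCh (uin_b.ite (const uinE ([] : List (List ℤ))) (scr_chain.comp uin_cur))).congr fun q => by
      rw [stableUpd_snd]
  refine data_withCur uin_d (scr_ofFields
    (setF 3 (setF 4 (setF 2 (setF 6 (scr_setF 5 uin_cur (ofStrE hsc')) (ofStrE hch')) (const uinE ([] : List Bool)))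
      (const uinE ([] : List Bool))) (const uinE (bitE false))) fun q => rfl)

/-- The facet branch (`fa`). [cite: FournierKoiran2000, §2.1 (the face of the cube hit by the ray)] -/
theorem faBrFP : CodeFP uinE dataE (fun q : UIn => faBr q.2.1 (q.2.2.1.args.getD 0 0) q.2.2.2) := by
  have hi : CodeFP uinE natE (fun q : UIn => q.2.2.1.args.getD 0 0) := uin_arg 0
  have hc0 : CodeFP uinE intE (fun q : UIn => vget q.2.1.chart (q.2.2.1.args.getD 0 0)) := (vgetFP.comp (uin_chart.pair hi) :)
  have hus : CodeFP uinE intE (fun q : UIn => usignAt q.2.1.cur.ge q.2.1.cur.le (q.2.2.1.args.getD 0 0)) :=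
    (usignAtFP.comp ((scr_ge.comp uin_cur).pair ((scr_le.comp uin_cur).pair hi)) :)
  have hv : CodeFP uinE bitE (fun q : UIn => q.2.1.validB (q.2.2.1.args.getD 0 0)) :=
    ((intEq.comp (hc0.pair (const uinE (0 : ℤ)))).and (intEq.comp (hus.pair (const uinE (0 : ℤ)))).not).congr fun q => by
      simp only [UData.validB, decide_not]
  have hcandL : CodeFP uinE (rawE natE) (fun q : UIn => q.2.1.cur.cand.toList) := optToRaw (scr_cand.comp uin_cur :)
  have hnew : CodeFP uinE (rawE natE) (fun q : UIn => (candUpd q.2.1.cur.cand (q.2.1.validB (q.2.2.1.args.getD 0 0)) q.2.2.2 (q.2.2.1.args.getD 0 0)).toList) :=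
    ((((rawIsEmpty natE).comp hcandL).ite (hv.ite ((rawSingleton natE).comp hi) (const uinE ([] : List ℕ)))
      ((hv.and uin_b.not).ite ((rawSingleton natE).comp hi) hcandL)).congr fun q => by rw [candUpd_toList])
  exact data_withCur uin_d (scr_ofFields (scr_setF 11 uin_cur (ofStrE (eβ := rawE natE) hnew)) fun q => rfl)

/-- The prefix-bit branch (`pf`). [cite: FournierKoiran2000, §2.1 (prefix search for the chain)] -/
theorem pfBrFP : CodeFP uinE dataE (fun q : UIn => pfBr q.1 q.2.1 (q.2.2.1.args.getD 2 0) q.2.2.2) := by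
  have hex : CodeFP uinE bitE (fun q : UIn => q.2.1.cur.exOk) := (scr_exOk.comp uin_cur :)
  have hwWf : CodeFP uinE bitE (fun q : UIn => decide (q.2.2.1.args.getD 2 0 + 1 = q.1.Wf)) :=
    (natEq.comp ((natAdd.comp ((uin_arg 2).pair (const uinE 1))).pair (natOfUn.comp uin_Wf)) :)
  have hdec : CodeFP uinE vecE (fun q : UIn => udecodeForm q.1.bB q.1.D (q.2.1.cur.bits ++ [q.2.2.2])) :=
    (udecodeFormFP.comp (uin_bB.pair (uin_D.pair uin_bits')) :)
  have hchain' : CodeFP uinE (rawE vecE) (fun q : UIn => q.2.1.cur.chain ++ [udecodeForm q.1.bB q.1.D (q.2.1.cur.bits ++ [q.2.2.2])]) :=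
    ((rawAppend vecE).comp ((scr_chain.comp uin_cur).pair ((rawSingleton vecE).comp hdec)) :)
  have hcurA : CodeFP uinE scrE (fun q : UIn => { q.2.1.cur with
      chain := q.2.1.cur.chain ++ [udecodeForm q.1.bB q.1.D (q.2.1.cur.bits ++ [q.2.2.2])], bits := [], exOk := false }) :=
    scr_ofFields (setF 3 (setF 4 (scr_setF 2 uin_cur (ofStrE hchain')) (const uinE ([] : List Bool))) (const uinE (bitE false)))
      fun _ => rfl
  have hcurB : CodeFP uinE scrE (fun q : UIn => { q.2.1.cur with bits := q.2.1.cur.bits ++ [q.2.2.2] }) :=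
    scr_ofFields (scr_setF 4 uin_cur uin_bits') fun _ => rfl
  exact ((hex.ite (hwWf.ite (data_withCur uin_d hcurA) (data_withCur uin_d hcurB)) uin_d :)).congr fun q => by
    simp only [pfBr, decide_eq_true_eq]

/-- The apex-bit branch (`ap`). [cite: FournierKoiran2000, §2.1 (prefix search for the apex)] -/
theorem apBrFP : CodeFP uinE dataE (fun q : UIn => apBr q.1 q.2.1 (q.2.2.1.args.getD 0 0) q.2.2.2) := by
  have hwWa : CodeFP uinE bitE (fun q : UIn => decide (q.2.2.1.args.getD 0 0 + 1 = q.1.Wa)) :=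
    (natEq.comp ((natAdd.comp ((uin_arg 0).pair (const uinE 1))).pair (natOfUn.comp uin_Wa)) :)
  have hdec : CodeFP uinE (pairE vecE natE) (fun q : UIn => udecodeApex q.1.W q.1.D (q.2.1.cur.bits ++ [q.2.2.2])) :=
    (udecodeApexFP.comp (uin_W.pair (uin_D.pair uin_bits')) :)
  have hcurA : CodeFP uinE scrE (fun q : UIn => { q.2.1.cur with
      apexN := (udecodeApex q.1.W q.1.D (q.2.1.cur.bits ++ [q.2.2.2])).1,
      apexD := (udecodeApex q.1.W q.1.D (q.2.1.cur.bits ++ [q.2.2.2])).2, bits := [] }) :=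
    scr_ofFields (setF 4 (setF 8 (scr_setF 7 uin_cur (ofStrE hdec.fst')) (ofStrE hdec.snd')) (const uinE ([] : List Bool)))
      fun _ => rfl
  have hcurB : CodeFP uinE scrE (fun q : UIn => { q.2.1.cur with bits := q.2.1.cur.bits ++ [q.2.2.2] }) :=
    scr_ofFields (scr_setF 4 uin_cur uin_bits') fun _ => rfl
  exact ((hwWa.ite (data_withCur uin_d hcurA) (data_withCur uin_d hcurB) :)).congr fun q => by
    simp only [apBr, decide_eq_true_eq]


/-- The binary-search branch (`bs`). [cite: FournierKoiran2000, §2.1 Step 1 (binary search on each coordinate)] -/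
theorem bsBrFP : CodeFP uinE dataE (fun q : UIn => bsBr q.1 q.2.1 (q.2.2.1.args.getD 0 0) (q.2.2.1.args.getD 1 0) q.2.2.2) := by
  have hi : CodeFP uinE natE (fun q : UIn => q.2.2.1.args.getD 0 0) := uin_arg 0
  have hk : CodeFP uinE natE (fun q : UIn => q.2.2.1.args.getD 1 0) := uin_arg 1
  have hc0 : CodeFP uinE intE (fun q : UIn => vget q.2.1.chart (q.2.2.1.args.getD 0 0)) := (vgetFP.comp (uin_chart.pair hi) :)
  have hpow : CodeFP uinE intE (fun q : UIn => (2 : ℤ) ^ (q.1.L + 1)) := (intPow.comp ((const uinE (2 : ℤ)).pair (unSucc.comp uin_L)) :)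
  have hkL : CodeFP uinE bitE (fun q : UIn => decide (q.2.2.1.args.getD 1 0 = q.1.L)) := (natEq.comp (hk.pair (natOfUn.comp uin_L)) :)
  have hm1 : CodeFP uinE vecE (fun q : UIn => q.2.1.cur.m.set (q.2.2.1.args.getD 0 0) (vget q.2.1.chart (q.2.2.1.args.getD 0 0) * 2 ^ (q.1.L + 1))) :=
    ((rawSet intE).comp ((scr_m.comp uin_cur).pair (hi.pair (intMul.comp (hc0.pair hpow)))) :)
  have hcur1 : CodeFP uinE scrE (fun q : UIn => { q.2.1.cur with
      m := q.2.1.cur.m.set (q.2.2.1.args.getD 0 0) (vget q.2.1.chart (q.2.2.1.args.getD 0 0) * 2 ^ (q.1.L + 1)), bsAcc := 0 }) :=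
    scr_ofFields (setF 1 (scr_setF 0 uin_cur (ofStrE hm1)) (const uinE ([] : List Bool))) fun _ => rfl
  have hacc : CodeFP uinE natE (fun q : UIn => if q.2.2.1.args.getD 1 0 = 0 then 0 else q.2.1.cur.bsAcc) :=
    ((natEq.comp (hk.pair (const uinE 0))).ite (const uinE 0) (scr_bsAcc.comp uin_cur)).congr fun q => by
      simp only [decide_eq_true_eq]
  have htoNat : CodeFP uinE natE (fun q : UIn => q.2.2.2.toNat) :=
    (uin_b.ite (const uinE 1) (const uinE 0)).congr fun q => by rcases q with ⟨P, d, τ, b⟩; cases b <;> rfl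
  have hacc' : CodeFP uinE natE (fun q : UIn => 2 * (if q.2.2.1.args.getD 1 0 = 0 then 0 else q.2.1.cur.bsAcc) + q.2.2.2.toNat) :=
    (natAdd.comp ((natMul.comp ((const uinE 2).pair hacc)).pair htoNat) :)
  have hv2 : CodeFP uinE intE (fun q : UIn =>
      2 * ((2 * (if q.2.2.1.args.getD 1 0 = 0 then 0 else q.2.1.cur.bsAcc) + q.2.2.2.toNat : ℕ) : ℤ) + 1 - 2 ^ (q.1.L + 1)) :=
    (intSub.comp ((intAdd.comp ((intMul.comp ((const uinE (2 : ℤ)).pair (intOfNat.comp hacc'))).pair (const uinE (1 : ℤ)))).pair hpow) :)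
  have hm2 : CodeFP uinE vecE (fun q : UIn => q.2.1.cur.m.set (q.2.2.1.args.getD 0 0)
      (2 * ((2 * (if q.2.2.1.args.getD 1 0 = 0 then 0 else q.2.1.cur.bsAcc) + q.2.2.2.toNat : ℕ) : ℤ) + 1 - 2 ^ (q.1.L + 1))) :=
    ((rawSet intE).comp ((scr_m.comp uin_cur).pair (hi.pair hv2)) :)
  have hcur2 : CodeFP uinE scrE (fun q : UIn => { q.2.1.cur with
      m := q.2.1.cur.m.set (q.2.2.1.args.getD 0 0)
        (2 * ((2 * (if q.2.2.1.args.getD 1 0 = 0 then 0 else q.2.1.cur.bsAcc) + q.2.2.2.toNat : ℕ) : ℤ) + 1 - 2 ^ (q.1.L + 1)),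
      bsAcc := 0 }) :=
    scr_ofFields (setF 1 (scr_setF 0 uin_cur (ofStrE hm2)) (const uinE ([] : List Bool))) fun _ => rfl
  have hcur3 : CodeFP uinE scrE (fun q : UIn => { q.2.1.cur with
      bsAcc := 2 * (if q.2.2.1.args.getD 1 0 = 0 then 0 else q.2.1.cur.bsAcc) + q.2.2.2.toNat }) :=
    scr_ofFields (scr_setF 1 uin_cur (ofStrE hacc')) fun _ => rfl
  have hne : CodeFP uinE bitE (fun q : UIn => decide (vget q.2.1.chart (q.2.2.1.args.getD 0 0) ≠ 0)) :=
    (intEq.comp (hc0.pair (const uinE (0 : ℤ)))).not.congr fun q => by simp only [decide_not]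
  exact ((hne.ite (hkL.ite (data_withCur uin_d hcur1) uin_d) (hkL.ite (data_withCur uin_d hcur2) (data_withCur uin_d hcur3)) :)).congr
    fun q => by simp only [bsBr, decide_eq_true_eq]


/-- **Closing a level** (`close`: `ufinishLevel`). [cite: FournierKoiran2000, §2.1 ("Otherwise we repeat the same procedure in dimension `n-1`")] -/
theorem closeBrFP : CodeFP uinE dataE (fun q : UIn => ufinishLevel q.1 q.2.1) := by
  have hcand : CodeFP uinE (optE natE) (fun q : UIn => q.2.1.cur.cand) := (scr_cand.comp uin_cur :)
  have hsome : CodeFP uinE bitE (fun q : UIn => q.2.1.cur.cand.isSome) := optIsSomeN hcand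
  have hc : CodeFP uinE natE (fun q : UIn => q.2.1.cur.cand.getD 0) := optGetD0 hcand
  have hgc : CodeFP uinE bitE (fun q : UIn => q.2.1.cur.ge.getD (q.2.1.cur.cand.getD 0) false) := (bgetFP.comp ((scr_ge.comp uin_cur).pair hc) :)
  have hε : CodeFP uinE intE (fun q : UIn => if q.2.1.cur.ge.getD (q.2.1.cur.cand.getD 0) false then (1 : ℤ) else -1) :=
    hgc.ite (const uinE (1 : ℤ)) (const uinE (-1 : ℤ))
  have hε' : CodeFP uinE intE (fun q : UIn =>
      if q.2.1.cur.cand.isSome then (if q.2.1.cur.ge.getD (q.2.1.cur.cand.getD 0) false then (1 : ℤ) else -1) else 1) :=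
    hsome.ite hε (const uinE (1 : ℤ))
  have hchart' : CodeFP uinE vecE (fun q : UIn =>
      if q.2.1.cur.cand.isSome then q.2.1.chart.set (q.2.1.cur.cand.getD 0)
        (if q.2.1.cur.ge.getD (q.2.1.cur.cand.getD 0) false then (1 : ℤ) else -1) else q.2.1.chart) :=
    hsome.ite ((rawSet intE).comp (uin_chart.pair (hc.pair hε)) :) uin_chart
  have hrec : CodeFP uinE lrecE (fun q : UIn => ucloseRec q.2.1.cur (q.2.1.cur.cand.getD 0)
      (if q.2.1.cur.cand.isSome then (if q.2.1.cur.ge.getD (q.2.1.cur.cand.getD 0) false then (1 : ℤ) else -1) else 1)) :=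
    (lrec_mk (scr_m.comp uin_cur) (optGetD0 (scr_stSc.comp uin_cur :)) (scr_apexN.comp uin_cur) (scr_apexD.comp uin_cur) hc hε').congr
      fun _ => rfl
  have hlevels : CodeFP uinE (rawE lrecE) (fun q : UIn => ucloseRec q.2.1.cur (q.2.1.cur.cand.getD 0)
      (if q.2.1.cur.cand.isSome then (if q.2.1.cur.ge.getD (q.2.1.cur.cand.getD 0) false then (1 : ℤ) else -1) else 1) :: q.2.1.levels) :=
    ((rawCons lrecE).comp (hrec.pair (data_levels.comp uin_d)) :)
  have hdone : CodeFP uinE bitE (fun q : UIn => if q.2.1.cur.cand.isSome then q.2.1.done else true) :=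
    hsome.ite (data_done.comp uin_d) (const uinE true)
  exact ((data_mk hdone (data_out.comp uin_d) hchart' hlevels (scrInitFP.comp uin_D) :)).congr fun q => by
    rw [ufinishLevel_eq]

end BranchesFP

/-! ### The transition -/


/-- **The transition of the location protocol is computed in polynomial time**:
`(P, d, τ, b) ↦ uupd P d τ b` on codes. [cite: FournierKoiran2000, §2.1 Steps 1 and k, Thm 3 (p. 11)] -/
theorem uupdFP : CodeFP uinE dataE (fun q : UIn => uupd q.1 q.2.1 q.2.2.1 q.2.2.2) := by
  have htag : ∀ k : ℕ, CodeFP uinE bitE (fun q : UIn => decide (q.2.2.1.tag = k)) := fun k =>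
    (natEq.comp ((task_tag.comp uin_τ).pair (const uinE k)) :)
  have hdone : CodeFP uinE bitE (fun q : UIn => q.2.1.done) := (data_done.comp uin_d :)
  exact ((hdone.ite uin_d ((htag 0).ite bsBrFP ((htag 1).ite exBrFP ((htag 2).ite pfBrFP ((htag 3).ite stBrFP
    ((htag 4).ite apBrFP ((htag 5).ite geBrFP ((htag 6).ite leBrFP ((htag 7).ite faBrFP ((htag 8).ite closeBrFP finBrFP))))))))) :)).congr
    fun q => by rw [uupd_eq]; simp only [decide_eq_true_eq]



end FKPointLocation

end Literature.Computability.Complexity
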